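import Summits.BirchSwinnertonDyer.BirchSwinnertonDyer.Theorems.ErratumRoadFiveNonSurjCornerSevenJLine
import Summits.BirchSwinnertonDyer.BirchSwinnertonDyer.Theorems.ErratumRoadFiveNonSurjCornerG9Group
import Literature.NumberTheory.EllipticCurves.ModFiveImageS4JLineProofs
import HarnessLib

/-!
# Route `ErratumRoadFive` (rung K2), crux `NonSurjCorner` (item stmt-BirchSwinnertonDyer-19065):
# THE `p = 5` BRANCH OF THE CORNER IS THE X11b PART OF ZYWINA'S RATIONAL CURVE `X_{G₉}` — every corner
# pair at `5` has `j(E) = J₉(t) = t³(t² + 5t + 40)`, `t ∈ ℚ`, and conversely; with the `p = 7` file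
# (`…NonSurjCornerSevenJLine`, `X_{N_s(7)}`): THE WHOLE CORNER IS THE X11b PART OF TWO RATIONAL CURVES
# (cell `bsd-stepL`, seat `bsd-stepL-corner5-p2` g5, WIDTH-LEVER lane B «class-level road»;
# `--supports stmt-BirchSwinnertonDyer-19065 --as helper`)

WHY THIS FILE. The registered stub `stub_corner5` of the crux (skeleton b2731b9ab55f) is the `p = 5` branch
`ClassX11b W 5 → ¬ Surj W 5 → … → MissingPPartAt W 5` — the whole census corner (64 class-pairs
`N < 5·10⁵`: 52 of image `5S4`, 12 of image `5Ns`; 5 TRUE-OPEN). This lane's g2 split it by one bit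
(`3 ∣ #G`: octahedral `5S4`, else the Cartan shape `G = N(C_s(5))`, `…NonSurjCornerShapeFive`) and g4 put the
`p = 7` branch on Zywina's `N_s(7)` j-line, leaving the `p = 5` j-line as OWED («needs an explicit
`G₉ ≤ GL₂(𝔽₅)` predicate»). Zywina's `G₉` — "the unique maximal subgroup of `GL₂(𝔽₅)` which contains
`N_s(5)`", index `5`, image `𝔖₄` in `PGL₂(𝔽₅)`, `J₉(t) = t³(t²+5t+40)` — CONTAINS `N_s(5)` (index `3`), so
BOTH image types of the census lie in it, and this file proves that EVERY corner pair at `5` does: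

* §1 `hasZywinaG9ModFiveImage_of_le_map_G9` — dictionary: a frame `(e, Φ)` of `E[5]` with
  `Φ(ρ̄(Γ_ℚ)) ≤ P G₉ P⁻¹` gives the explicit-basis predicate `HasZywinaG9ModFiveImage W` of the Literature
  file `ModFiveImageZywinaG9` (basis `x ↦ P⁻¹ · e x`; the `G₉` twin of the Serre-uniformity dictionary);
* §2 **`hasZywinaG9ModFiveImage_of_mult_of_irr_of_not_surj`**: `Mult W 5 ∧ Irr W 5 ∧ ¬ Surj W 5` ⟹
  `HasZywinaG9ModFiveImage W`. Proof: `5 ∤ #G` (Serre Prop. 15, tree theorem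
  `not_dvd_card_of_not_hasSurjectiveModNGaloisRep`); the inertia group at a prime above `5` maps ONTO a
  split half-Cartan subgroup `P (1 0; 0 *) P⁻¹ ≤ G` (Serre §1.12 + §2.1 a) at the Tate curve — x11c gen 7's
  `GaloisImage.exists_halfSplitCartan_eq_inertia_image_of_mult`); and a `5'`-subgroup of `GL₂(𝔽₅)`
  containing a split half-Cartan subgroup lies in `P G₉ P⁻¹` — the tool file's theorem
  `ZywinaG9.le_map_G9_of_halfSplitCartan_le` (`…NonSurjCornerG9Group`) (a finite certificate: an element outside `G₉` would
  produce an element of order `5`; conceptually `{diag(1,u)}` is a `4`-cycle of `PGL₂(𝔽₅) ≅ 𝔖₅` and `G₉`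
  the stabiliser of its fixed point). NO hypothesis `3 ∣ #G`/`3 ∤ #G`: both of g2's branches at once;
* §3 **`NonSurjCorner.exists_j_eq_J9_five`**: every corner pair at `5` (`ClassX11b W 5 ∧ ¬ Surj W 5`) has
  `j(W) = t³(t² + 5t + 40)` for some `t ∈ ℚ`, modulo Zywina 2015 Thm. 1.4 (`i = 9`, «only if») BY NAME
  (`hZ : zywina2015_thm14_exists_j_eq_J9_of_zywinaG9_five`, Literature file `ModFiveImageZywinaG9`; a
  multiplicative prime excludes CM); the same for the X11a leaf twins (`NonSurjTwin.exists_j_eq_J9_five`);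
  **`NonSurjCorner.not_surj_five_iff_exists_j_eq_J9`**: on class X11b at `5`, `¬ Surj W 5 ⟺ ∃ t ∈ ℚ,
  j(W) = J₉(t)` — the «if» half is a THEOREM of the tree (bsd-print-x9's
  `zywina2015_thm14_not_surjective_five_of_j_eq_J9_holds`), so only ONE direction is taken by name;
* §4 **`NonSurjCorner.exists_j_mem_two_lines`**: for every corner pair `(E, p)` of the crux (`p = 5 ∨ p = 7`):
  `p = 5 ∧ j(E) ∈ J₉(ℚ)` or `p = 7 ∧ j(E) ∈ J₂⁽⁷⁾(ℚ)` (g4's `NonSurjCorner.exists_j_eq_J2_seven`) — the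
  corner is the X11b part of `X_{G₉}(ℚ) ⊔ X_{N_s(7)}(ℚ)`, two copies of `ℙ¹(ℚ)`.

HONEST FRAMING: structure theorems + ONE new cite-tagged named fact (Zywina 2015 Thm. 1.4, `i = 9`,
«only if»: a published modular-curve computation, consumed by name; nothing is asserted about it) + g4's
`ℓ = 7` fact in §4; nothing here proves the crux, a registered stub or BSD for any class; no census number
moves (T7). The binders `p ∣ ord_p Δ_min` and `¬Ram` of the crux are not used (they FOLLOW on the corner,
this lane g2/g3).
References: [Zywina2015] §1.3 (`G₉`, `J₉`, indices), Thm. 1.4 (arXiv:1508.07660 pp. 4–5), §1.4 / Thm. 1.5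
(`N_s(7)`); [Serre1972] §1.12, §2.1 a), §2.4 Prop. 15, §2.6; [SilvermanATAEC1994] Thm. II.6.4 (CM ⟹ no
multiplicative prime).
-/

set_option linter.dupNamespace false -- `Summit.BirchSwinnertonDyer.BirchSwinnertonDyer` (summit = problem), tree-wide

noncomputable section

namespace Summit.BirchSwinnertonDyer.BirchSwinnertonDyer.Theorems.CornerShape

open scoped Classical NumberField MatrixGroups
open IsDedekindDomain Field Matrix NumberField WeierstrassCurve
  Literature.NumberTheory.EllipticCurves
  Literature.NumberTheory.EllipticCurves.Rank1Residual
  Literature.NumberTheory.EllipticCurves.Zywina2015G9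
  Summit.BirchSwinnertonDyer.BirchSwinnertonDyer.Theorems.ZywinaG9
  Literature.NumberTheory.GaloisRepresentations
  Literature.NumberTheory.GaloisRepresentations.Serre1972
  Literature.NumberTheory.SerreUniformity
  Rat.HeightOneSpectrum
  Summit.BirchSwinnertonDyer.Rank1Residual

/-! ### §1. Dictionary: frame statement ⟹ the explicit-basis predicate `HasZywinaG9ModFiveImage` -/

/-- **Dictionary.** If in a frame `(e, Φ)` of `E[5]` the image `Φ(ρ̄_{W,5}(Γ_ℚ))` is contained in the
conjugate `P G₉ P⁻¹` of Zywina's `G₉`, then in the basis `x ↦ P⁻¹ · e x` every `σ ∈ Γ_ℚ` acts through a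
matrix of `G₉`: `HasZywinaG9ModFiveImage W` (the matrix of `σ` in the new basis is `P⁻¹ Φ(ρ̄ σ) P`).
The `G₉` twin of `SerreUniformity.hasSplitCartanNormalizerModPImage_of_le_normalizer_splitCartan`.
[cite: Zywina2015, Thm. 1.4 (second item) and §1.3 (G₉) (arXiv:1508.07660 pp. 4–5)] -/
theorem hasZywinaG9ModFiveImage_of_le_map_G9 (W : WeierstrassCurve ℚ)
    (Φ : Multiplicative (AddAut (geomTorsion W 5)) ≃* GL (Fin 2) (ZMod 5))
    (e : geomTorsion W 5 ≃+ (Fin 2 → ZMod 5))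
    (he : ∀ (g : Multiplicative (AddAut (geomTorsion W 5))) (x : geomTorsion W 5),
      e (Multiplicative.toAdd g x) =
        ((Φ g : GL (Fin 2) (ZMod 5)) : Matrix (Fin 2) (Fin 2) (ZMod 5)) *ᵥ e x)
    {P : GL (Fin 2) (ZMod 5)}
    (hle : (galoisRepTorsion W 5).range.map Φ.toMonoidHom ≤ G9.map (MulAut.conj P).toMonoidHom) :
    HasZywinaG9ModFiveImage W := by
  have hPinv : ((P : GL (Fin 2) (ZMod 5)) : Matrix (Fin 2) (Fin 2) (ZMod 5)) *
      ((P⁻¹ : GL (Fin 2) (ZMod 5)) : Matrix (Fin 2) (Fin 2) (ZMod 5)) = 1 := by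
    rw [← Units.val_mul, mul_inv_cancel, Units.val_one]
  have hinvP : ((P⁻¹ : GL (Fin 2) (ZMod 5)) : Matrix (Fin 2) (Fin 2) (ZMod 5)) *
      ((P : GL (Fin 2) (ZMod 5)) : Matrix (Fin 2) (Fin 2) (ZMod 5)) = 1 := by
    rw [← Units.val_mul, inv_mul_cancel, Units.val_one]
  let Q : (Fin 2 → ZMod 5) ≃+ (Fin 2 → ZMod 5) :=
    { toFun := fun v ↦ ((P⁻¹ : GL (Fin 2) (ZMod 5)) : Matrix (Fin 2) (Fin 2) (ZMod 5)) *ᵥ v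
      invFun := fun v ↦ ((P : GL (Fin 2) (ZMod 5)) : Matrix (Fin 2) (Fin 2) (ZMod 5)) *ᵥ v
      left_inv := fun v ↦ by
        simp only [Matrix.mulVec_mulVec, hPinv, Matrix.one_mulVec]
      right_inv := fun v ↦ by
        simp only [Matrix.mulVec_mulVec, hinvP, Matrix.one_mulVec]
      map_add' := fun v w ↦ Matrix.mulVec_add _ _ _ }
  have hQ : ∀ v, Q v = ((P⁻¹ : GL (Fin 2) (ZMod 5)) : Matrix (Fin 2) (Fin 2) (ZMod 5)) *ᵥ v :=
    fun v ↦ rfl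
  refine ⟨e.trans Q, fun σ ↦ ?_⟩
  obtain ⟨M, hM, hMeq⟩ := hle (apply_galoisRepTorsion_mem_map_range W 5 Φ σ)
  have hPM : Φ (galoisRepTorsion W (5 : ℕ) σ) = P * M * P⁻¹ := by rw [← hMeq]; rfl
  refine ⟨M, hM, fun x ↦ ?_⟩
  have hmat : ((P⁻¹ : GL (Fin 2) (ZMod 5)) : Matrix (Fin 2) (Fin 2) (ZMod 5)) *
      ((P * M * P⁻¹ : GL (Fin 2) (ZMod 5)) : Matrix (Fin 2) (Fin 2) (ZMod 5)) =
        ((M : GL (Fin 2) (ZMod 5)) : Matrix (Fin 2) (Fin 2) (ZMod 5)) *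
          ((P⁻¹ : GL (Fin 2) (ZMod 5)) : Matrix (Fin 2) (Fin 2) (ZMod 5)) := by
    rw [← Units.val_mul, ← Units.val_mul]
    congr 1
    group
  rw [AddEquiv.trans_apply, AddEquiv.trans_apply, hQ, hQ, ← galoisRepTorsion_apply W (5 : ℕ) σ x,
    he (galoisRepTorsion W (5 : ℕ) σ) x, hPM, Matrix.mulVec_mulVec, Matrix.mulVec_mulVec, hmat]

/-! ### §2. `Mult ∧ Irr ∧ ¬Surj` at `5`: the image is conjugate into `G₉` -/

/-- **At a multiplicative `5` with `E[5]` irreducible and `ρ̄_{E,5}` not onto, the mod-`5` image is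
conjugate to a subgroup of Zywina's `G₉`.** In a frame `(e, Φ)`: `5 ∤ #G` (Serre Prop. 15: `Irr`, `¬Surj`,
`det` onto — the tree's `not_dvd_card_of_not_hasSurjectiveModNGaloisRep`), and the inertia group at a
prime above `5` maps ONTO a split half-Cartan subgroup `P (1 0; 0 *) P⁻¹ ≤ G` (Serre §1.12 + §2.1 a) at
the Tate curve — x11c's `GaloisImage.exists_halfSplitCartan_eq_inertia_image_of_mult`); a `5'`-subgroup of
`GL₂(𝔽₅)` containing a split half-Cartan subgroup lies in `P G₉ P⁻¹`
(`ZywinaG9.le_map_G9_of_halfSplitCartan_le`, file `…NonSurjCornerG9Group`, a finite computation); then the dictionary of §1.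
(Compare `p ≥ 7`: there the image lies in `N(C_s(p))`, this lane g4's
`hasSplitCartanNormalizerModPImage_of_mult_of_irr_of_not_surj`; at `p = 5` the octahedral group `G₉ ⊋
N_s(5)` genuinely occurs — `5S4`, 52 of the 64 census corner pairs.)
[cite: Serre1972, §1.12 (Cor. of Prop. 13), §2.1 a), §2.4 Prop. 15] [cite: Zywina2015, §1.3 (G₉)] -/
theorem hasZywinaG9ModFiveImage_of_mult_of_irr_of_not_surj (W : WeierstrassCurve ℚ) [W.IsElliptic]
    [Fact (Nat.Prime 5)] (hmult : Mult W 5) (hirr : Irr W 5) (hns : ¬ Surj W 5) :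
    HasZywinaG9ModFiveImage W := by
  obtain ⟨e, Φ, he, -⟩ := exists_frame_galoisRepTorsion_rat W 5
  have hpG : ¬ 5 ∣ Nat.card ((galoisRepTorsion W 5).range.map Φ.toMonoidHom) :=
    not_dvd_card_of_not_hasSurjectiveModNGaloisRep W 5 Φ e he hirr hns
  -- the place `v = (5)` and a prime of `ℚ̄` above it
  have hpp : Nat.Prime 5 := Fact.out
  set v : HeightOneSpectrum (𝓞 ℚ) := (primesEquiv (R := 𝓞 ℚ)).symm ⟨5, hpp⟩ with hvdef
  have hv' : primesEquiv v = ⟨5, hpp⟩ := Equiv.apply_symm_apply _ _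
  have hv : (primesEquiv v : ℕ) = 5 := congrArg Subtype.val hv'
  obtain ⟨𝔏, h𝔏⟩ := HeightOneSpectrum.primesAbove_nonempty v
  obtain ⟨P, hP⟩ :=
    GaloisImage.exists_halfSplitCartan_eq_inertia_image_of_mult W 5 Φ e he (by decide) hmult hpG hv h𝔏
  have hCG : halfSplitCartan P ≤ (galoisRepTorsion W 5).range.map Φ.toMonoidHom := by
    rw [← hP]
    exact Subgroup.map_mono (fun x ⟨τ, _, hτ⟩ ↦ ⟨τ, hτ⟩)
  exact hasZywinaG9ModFiveImage_of_le_map_G9 W Φ e he (le_map_G9_of_halfSplitCartan_le hpG hCG)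

/-- **Every corner pair at `p = 5` gives a `ℚ`-point of `X_{G₉}`**: `ClassX11b W 5 ∧ ¬ Surj W 5` ⟹
`HasZywinaG9ModFiveImage W` (class X11b carries `Mult W 5` and `Irr W 5`).
[cite: Serre1972, §2.4 Prop. 15] [cite: Zywina2015, §1.3 (G₉), Thm. 1.4] -/
theorem NonSurjCorner.hasZywinaG9ModFiveImage_five (W : WeierstrassCurve ℚ) [W.IsElliptic]
    [Fact (Nat.Prime 5)] (hX : ClassX11b W 5) (hns : ¬ Surj W 5) : HasZywinaG9ModFiveImage W :=
  hasZywinaG9ModFiveImage_of_mult_of_irr_of_not_surj W hX.2.2.1 hX.2.2.2 hns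

/-! ### §3. The `p = 5` corner on Zywina's `J₉`-line -/

/-- **EVERY CORNER PAIR AT `p = 5` LIES ON ZYWINA'S `G₉` j-LINE**: for `(E, 5)` in class X11b
(`r_an = 1`, `5 ∥ N`, `E[5]` irreducible) with `ρ̄_{E,5}` NOT onto there is `t ∈ ℚ` with
`j(E) = J₉(t) = t³(t² + 5t + 40)` (given Zywina's Thm. 1.4, `i = 9`, ⟹, by name: `hZ`; a multiplicative
prime excludes CM). The whole census corner at `5` (64 class-pairs `N < 5·10⁵`: 52 of image `5S4 = G₉`,
12 of image `5Ns = N_s(5) ≤ G₉`) is on this line. [cite: Zywina2015, Thm. 1.4 (second item, i = 9), §1.3]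
[cite: SilvermanATAEC1994, Thm. II.6.4] -/
theorem NonSurjCorner.exists_j_eq_J9_five (W : WeierstrassCurve ℚ) [W.IsElliptic] [Fact (Nat.Prime 5)]
    (hZ : zywina2015_thm14_exists_j_eq_J9_of_zywinaG9_five) (hX : ClassX11b W 5) (hns : ¬ Surj W 5) :
    ∃ t : ℚ, W.j = t ^ 3 * (t ^ 2 + 5 * t + 40) :=
  hZ W (NonSurjCorner.not_hasCM W 5 hX) (NonSurjCorner.hasZywinaG9ModFiveImage_five W hX hns)

/-- The same for the rank-0 X11a LEAF TWINS of the corner at `5` (child 19948; `ClassX11a Wd 5 ∧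
¬ Surj Wd 5`): `j(Wd) = t³(t² + 5t + 40)` for some `t ∈ ℚ`. [cite: Zywina2015, Thm. 1.4 (second item, i = 9), §1.3] -/
theorem NonSurjTwin.exists_j_eq_J9_five (W : WeierstrassCurve ℚ) [W.IsElliptic] [W.IsGloballyMinimal]
    [Fact (Nat.Prime 5)] (hZ : zywina2015_thm14_exists_j_eq_J9_of_zywinaG9_five) (hXa : ClassX11a W 5)
    (hns : ¬ Surj W 5) : ∃ t : ℚ, W.j = t ^ 3 * (t ^ 2 + 5 * t + 40) :=
  hZ W (fun hCM => not_mult_of_hasCM W hCM 5 hXa.2.2.1)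
    (hasZywinaG9ModFiveImage_of_mult_of_irr_of_not_surj W hXa.2.2.1 hXa.2.2.2.1 hns)

/-- **THE `p = 5` CORNER IS EXACTLY THE X11b PART OF THE `J₉`-LINE**: on class X11b at `5`, `ρ̄_{E,5}`
is NOT onto iff `j(E) = t³(t² + 5t + 40)` for some `t ∈ ℚ` — ⟹ by Zywina's «only if» half (`hZ`, by
name) and ⟸ by the «if» half, which is a THEOREM of the tree
(`zywina2015_thm14_not_surjective_five_of_j_eq_J9_holds`, file `ModFiveImageS4JLineProofs`); CM is
excluded by the multiplicative prime `5`. So the registered stub `stub_corner5` quantifies over the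
rational points `t` of a `ℙ¹` meeting class X11b. [cite: Zywina2015, Thm. 1.4 (second item, i = 9), §1.3 (arXiv:1508.07660 pp. 4–5)] -/
theorem NonSurjCorner.not_surj_five_iff_exists_j_eq_J9 (W : WeierstrassCurve ℚ) [W.IsElliptic]
    [Fact (Nat.Prime 5)] (hZ : zywina2015_thm14_exists_j_eq_J9_of_zywinaG9_five) (hX : ClassX11b W 5) :
    ¬ Surj W 5 ↔ ∃ t : ℚ, W.j = t ^ 3 * (t ^ 2 + 5 * t + 40) :=
  ⟨NonSurjCorner.exists_j_eq_J9_five W hZ hX,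
    fun ⟨t, hj⟩ => zywina2015_thm14_not_surjective_five_of_j_eq_J9_holds W
      (NonSurjCorner.not_hasCM W 5 hX) t hj⟩

/-! ### §4. The whole corner: two rational curves -/

/-- **THE CORNER IS THE X11b PART OF TWO RATIONAL CURVES.** For every corner pair `(E, p)` of crux
`NonSurjCorner` — `ClassX11b W p`, `ρ̄_{E,p}` not onto, `p = 5 ∨ p = 7` — EITHER `p = 5` and
`j(E) = t³(t² + 5t + 40)` (Zywina's `X_{G₉}`), OR `p = 7` and `j(E) = J₂(t)`, i.e.
`j(E)·(t³−4t²+3t+1)⁷ = t(t+1)³(t²−5t+1)³(t²−5t+8)³(t⁴−5t³+8t²−7t+7)³` (Zywina's `X_{N_s(7)}`, this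
lane g4's `NonSurjCorner.exists_j_eq_J2_seven`), for some `t ∈ ℚ`; given the two «only if» halves of
Zywina's Thms. 1.4 / 1.5 by name (`hZ5`, `hZ7`). The crux binders `p ∣ ord_p Δ_min` and `¬Ram` are not
used (they follow, this lane g2/g3). [cite: Zywina2015, Thm. 1.4 (i = 9), Thm. 1.5 (i = 2) (arXiv:1508.07660 pp. 4–6)] -/
theorem NonSurjCorner.exists_j_mem_two_lines (W : WeierstrassCurve ℚ) [W.IsElliptic] (p : ℕ)
    [Fact p.Prime] (hZ5 : zywina2015_thm14_exists_j_eq_J9_of_zywinaG9_five)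
    (hZ7 : zywina2015_thm15_exists_j_eq_J2_of_splitCartanNormalizer_seven)
    (hX : ClassX11b W p) (hns : ¬ Surj W p) (hp : p = 5 ∨ p = 7) :
    (p = 5 ∧ ∃ t : ℚ, W.j = t ^ 3 * (t ^ 2 + 5 * t + 40)) ∨
      (p = 7 ∧ ∃ t : ℚ, t ^ 3 - 4 * t ^ 2 + 3 * t + 1 ≠ 0 ∧
        W.j * (t ^ 3 - 4 * t ^ 2 + 3 * t + 1) ^ 7 =
          t * (t + 1) ^ 3 * (t ^ 2 - 5 * t + 1) ^ 3 * (t ^ 2 - 5 * t + 8) ^ 3 *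
            (t ^ 4 - 5 * t ^ 3 + 8 * t ^ 2 - 7 * t + 7) ^ 3) := by
  rcases hp with rfl | rfl
  · exact Or.inl ⟨rfl, NonSurjCorner.exists_j_eq_J9_five W hZ5 hX hns⟩
  · exact Or.inr ⟨rfl, NonSurjCorner.exists_j_eq_J2_seven W hZ7 hX hns⟩

end Summit.BirchSwinnertonDyer.BirchSwinnertonDyer.Theorems.CornerShape

end
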